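import Literature.NumberTheory.GaloisRepresentations.LevelFieldLocalization
import Literature.NumberTheory.EllipticCurves.Kato2004.EulerSystemValues
import Summits.BirchSwinnertonDyer.BirchSwinnertonDyer.Theorems.KimAtThreeFineKatoLevelExactness
import HarnessLib

/-!
# The COMPAT clause of the defined-Kato package `hK` (registered stub `stub_definedKatoPackage` of crux
# `KatoKuriharaPortThreeShared`, stmt-BirchSwinnertonDyer-19560) DISCHARGED from a semi-locally DEFINED
# value datum — Galois side (cell `bsd-addord`, seat w2-acc5 gen 4; route W2; `--supports 19560`, helper)

HONEST FRAMING. TOOL theorems only (no definition, no named fact, no `sorry`); closes nothing; nothing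
is booked; BSD is not proved by any of this.  kim3 gen 13's `KimAtThreeFineKatoRiderAssembly` (p490927)
reduced the crux's fine Kato package to a displayed «defined-Kato package» `hK` whose semi-local part
carries, per depth `j` and tame level `r` (`m = cycLevel p 0 r`, `A = ℚ_p ⊗_ℚ ℚ(ζ_m)`), the clause
COMPAT: `res_U κ₀ = Ψ y → loc_v κ₀ = π_{j+1,*} h → ∃ μ ∈ M, φ h ⊗ 1 − p⁰·Λ_{0,r}(y) = p^{j+1}·μ`
(`y ∈ H¹(U, T_pE)` a level class, `h ∈ H¹(ℚ_v, T_pE)`, `φ = exp*_ω` at `ℚ_v`, `Λ` Kato's value datum,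
`M` the semi-local `exp*`-lattice) — «exactness over each `K_𝔓` + restriction compatibility of `exp*` +
`Λ := (exp*_ω ∘ loc_𝔓)_𝔓` DEFINED» (kim3, HOME STATUS l.1137).  THIS FILE proves COMPAT from exactly
such a definition (§3 `compat_of_semiLocalDef`, hK-verbatim form `compat_of_semiLocalDef_pow_zero`), for
ANY finite family of fields `F_w ⊇ ℚ_v` whose tower restrictions `Γ_{F_w} → Γ_{ℚ_v} → Γ_ℚ` land in the
level `U` (§1: as soon as `F_w ∋ ζ_m`; w2-acc4's model `w.1.adicCompletion (CyclotomicField m ℚ)`,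
`w : v.Extension`, included), ANY additive `φ_w : H¹(Γ_{F_w}, T_pE) → V_w` on the TOWER-restricted Tate
module `(tateLocalRep W p v).restrict res_{F_w/ℚ_v}` (the currency of the `p`-adic Hodge theory files)
and ANY additive `ι_w : V_w → A`, under three hypotheses on the abstract data:
(DEF) `Λ_{k,r}(y) = Σ_w ι_w (φ_w (loc_w y))`, on cocycles (`loc_w` = `LevelFieldLocalization.locTower`
across the scalar change `ℤ_[p] ↝ ℤ`, pointwise `σ ↦ y(res_{ℚ_v/ℚ}(res_{F_w/ℚ_v} σ))`);
(RES) `Σ_w ι_w (φ_w (res_{F_w/ℚ_v} h)) = φ(h) ⊗ 1` (restriction functoriality of a defined `exp*`);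
(LAT) `Σ_w ι_w (φ_w (z_w)) ∈ M` for every family `z`.
Proof: `π_{j+1,*}(res_w h) = res_w(loc_v κ₀) = loc_w^{tower}(res_U κ₀) = loc_w^{tower}(Ψ y) =
π_{j+1,*}(loc_w y)` in `H¹(Γ_{F_w}, E[p^{j+1}])` (the honest tower identity
`LevelFieldLocalization.locTower_resSubgroup` + cocycle formulas), exactness over `Γ_{F_w}`
(`KimAtThreeFineKatoLevelExactness.exists_sub_eq_zsmul_of_cohomologyMap_eq`), then `φ_w`, `ι_w`, `Σ_w`.
Also: §1 `absGaloisRestrictTower_mem_cycSubgroup` (`F ∋ ζ_m`, `m = cycLevel p k r` ⇒ tower restriction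
`∈ cycSubgroup p k r`); §2 `locTower_eq_zero_of_forall_primesAbove` (a level class satisfying
`Kato2004.ZetaBody` (C3b)'s «dies on every `U ⊓ MulAction.stabilizer Γ_ℚ 𝔓`, `𝔓 ∣ p`» has
`loc_w^{tower} = 0`: a Λ DEFINED by (DEF) meets (C3b)).  Every `p`, `v`, `j`, `(k, r)`.  After this
file COMPAT costs the DEFINITION of `Λ` (Kato-v2, gated on `defn-EllipticNeronDeRhamClass`) and the two
standard properties (RES)/(LAT) of a defined `exp*` — nothing Galois-theoretic.

References: K. Kato, Astérisque 295 (2004) §9.4, Thm. 9.7 [Kato2004Asterisque]; C.-H. Kim, AJM 148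
(2026) §3.3–§3.4.1, proof of Thm. 3.13 [Kim2022StructureSelmer]; K. Rubin, *Euler Systems* (2000)
Ch. IV §4 [Rubin2000]; J.-P. Serre, *Galois Cohomology* (1997) I §2.4 [SerreGaloisCohomology1997];
kim3 `Theorems/KimAtThreeFineKatoRiderAssembly.lean` (p490927), memo KIM3-W2-C1b-KERNEL-g13 §3.
-/

noncomputable section

-- the cell's Theorems namespace `Summit.BirchSwinnertonDyer.BirchSwinnertonDyer.…` repeats the summit name by design (D-0017)
set_option linter.dupNamespace false

open scoped Classical NumberField ContRepresentation TensorProduct Pointwise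
open Field NumberField IsDedekindDomain
open WeierstrassCurve Literature.NumberTheory.EllipticCurves Literature.NumberTheory.GaloisRepresentations
  Literature.NumberTheory.GaloisRepresentations.DiscreteGaloisModule
  Literature.NumberTheory.EllipticCurves.Kato2004.EulerSystemValues
open Summit.BirchSwinnertonDyer.Rank1Residual.GaloisImage
open Summit.BirchSwinnertonDyer.BirchSwinnertonDyer.Theorems.KimAtThreeFineKatoLevelExactness

namespace Summit.BirchSwinnertonDyer.BirchSwinnertonDyer.Theorems.KimAtThreeFineKatoLevelCompat

/-! ## §1. Tower restrictions of a field containing `ζ_m` land in the level `cycSubgroup p k r` -/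

section Level

variable (p : ℕ) [hp : Fact p.Prime] (k : ℕ) (r : Finset (HeightOneSpectrum (𝓞 ℚ)))

/-- **If `F ∋` a primitive `m`-th root of unity, `m = cycLevel p k r = p^k · ∏_{q∈r} ℓ_q`, the tower
restriction `Γ_F → Γ_E → Γ_ℚ` lands in the level `cycSubgroup p k r`** (= `Gal(ℚ̄/ℚ(μ_{p^k})) ⊓ ⨅_q
Gal(ℚ̄/ℚ(μ_{ℓ_q}))`; each factor divides `m`). [cite: Rubin2000, Ch. III §2.1] -/
theorem absGaloisRestrictTower_mem_cycSubgroup (E F : Type) [Field E] [Field F] [Algebra ℚ E]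
    [Algebra E F] [Algebra ℚ F] [IsScalarTower ℚ E F] {ζ : F}
    (hζ : IsPrimitiveRoot ζ (cycLevel p k r)) (σ : absoluteGaloisGroup F) :
    absGaloisRestrictTower ℚ E F σ ∈ cycSubgroup p k r := by
  change _ ∈ (cyclotomicLevelsRat p (∅ : Set (HeightOneSpectrum (𝓞 ℚ)))).level k r
  rw [cyclotomicLevelsRat_level]
  refine ⟨absGaloisRestrictTower_mem_rootsOfUnityFixer_of_dvd ℚ E F hζ (Dvd.intro _ rfl) σ, ?_⟩
  refine Subgroup.mem_iInf.2 fun q => Subgroup.mem_iInf.2 fun hq => ?_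
  exact absGaloisRestrictTower_mem_rootsOfUnityFixer_of_dvd ℚ E F hζ
    ((Finset.dvd_prod_of_mem _ hq).mul_left _) σ

end Level

/-! ## §2. The (C3b) "local at `p`" binder kills every tower localisation -/

section LocalAtP

variable {R : Type*} [CommRing R] [TopologicalSpace R]

/-- **A level class that dies on every `U ⊓ MulAction.stabilizer Γ_ℚ 𝔓`, `𝔓 ∈ v.primesAbove` — the
hypothesis of `Kato2004.ZetaBody` (C3b) — has vanishing tower localisation at every field `F ⊇ ℚ_v`**
(`𝔓 = adicCompletionPrime ℚ v`): a value datum DEFINED through `loc_tower` is "local at `p`".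
[cite: Kato2004Asterisque, §9.4 (exp* is a map on the semi-local cohomology at p)] -/
theorem locTower_eq_zero_of_forall_primesAbove (X : TopRep.{0} R (absoluteGaloisGroup ℚ))
    (v : HeightOneSpectrum (𝓞 ℚ)) (F : Type) [Field F] [Algebra (v.adicCompletion ℚ) F]
    {U : Subgroup (absoluteGaloisGroup ℚ)}
    (hU : ∀ σ, absGaloisRestrictTower ℚ (v.adicCompletion ℚ) F σ ∈ U) (n : ℕ)
    (y : continuousCohomology n (subgroupRep X U))
    (hy : ∀ 𝔓 ∈ v.primesAbove,
      resLe X (inf_le_left : U ⊓ MulAction.stabilizer (absoluteGaloisGroup ℚ) 𝔓 ≤ U) n y = 0) :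
    locTower ℚ (v.adicCompletion ℚ) F X U hU n y = 0 :=
  locTower_eq_zero_of_resLe_inf_eq_zero ℚ v F X hU n y (hy _ (adicCompletionPrime_mem_primesAbove ℚ v))

end LocalAtP

/-! ## §3. COMPAT from a semi-locally defined value datum -/

section Compat

variable (W : WeierstrassCurve ℚ) [W.IsElliptic] (p : ℕ) [hp : Fact p.Prime]
  [ContinuousSMul ℤ_[p] (W.tateModule p)] (j k : ℕ) (r : Finset (HeightOneSpectrum (𝓞 ℚ)))
  (v : HeightOneSpectrum (𝓞 ℚ))

/-- The push-forward `π_{j+1} ∘ φ'` of a LEVEL cocycle `φ' : U → T_pE` to `E[p^j·p]`. [folklore] -/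
theorem exists_level_pushCocycle (U : Subgroup (absoluteGaloisGroup ℚ))
    (φ' : contOneCocycles (subgroupRep (tateRep W p).toTopRep U)) :
    ∃ ψ : contOneCocycles (subgroupRep
        (W.torsionGaloisModule ((p : ℤ) ^ j * (p : ℤ))).toTopRep U),
      ∀ g, ψ.1 g = tateToTorsion W p j (φ'.1 g) := by
  refine ⟨⟨⟨fun g => tateToTorsion W p j (φ'.1 g),
    (continuous_tateToTorsion W p j).comp φ'.1.continuous⟩, fun g h => ?_⟩, fun _ => rfl⟩
  apply Subtype.ext
  change ((tateToTorsion W p j (φ'.1 (g * h)) : geomTorsion W _) : geomPoints W) =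
    ((tateToTorsion W p j (φ'.1 g) + (subgroupRep (W.torsionGaloisModule ((p : ℤ) ^ j * (p : ℤ))).toTopRep
      U).ρ g (tateToTorsion W p j (φ'.1 h)) : geomTorsion W _) : geomPoints W)
  rw [φ'.2 g h]
  rfl

/-- The TOWER localisation of a LEVEL cocycle `φ' : U → T_pE` at `F ⊇ ℚ_v`, as a `ℤ`-linear cocycle of
`Γ_F` acting through `Γ_F → Γ_{ℚ_v} → Γ_ℚ` (the scalar change `ℤ_[p] ↝ ℤ` from `H1 (tateRep W p) U` to
`((tateLocalRep W p v).restrict res_{F/ℚ_v}).cohomology 1`), `σ ↦ φ'(res(res σ))`. [folklore] -/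
theorem exists_level_towerCocycle (F : Type) [Field F] [Algebra (Place.Completion (Sum.inr v)) F]
    (U : Subgroup (absoluteGaloisGroup ℚ))
    (hU : ∀ σ, absGaloisRestrictTower ℚ (Place.Completion (Sum.inr v)) F σ ∈ U)
    (φ' : contOneCocycles (subgroupRep (tateRep W p).toTopRep U)) :
    ∃ ψ : contOneCocycles ((tateLocalRep W p (Sum.inr v)).restrict
        (absGaloisRestrict (Place.Completion (Sum.inr v)) F)).toTopRep,
      ∀ σ, ψ.1 σ = φ'.1 ⟨absGaloisRestrictTower ℚ (Place.Completion (Sum.inr v)) F σ, hU σ⟩ := by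
  refine ⟨⟨⟨fun σ => φ'.1 ⟨absGaloisRestrictTower ℚ (Place.Completion (Sum.inr v)) F σ, hU σ⟩,
    φ'.1.continuous.comp (absGaloisRestrictTowerInto ℚ (Place.Completion (Sum.inr v)) F U hU).continuous⟩,
    fun g h => ?_⟩, fun _ => rfl⟩
  change φ'.1 (absGaloisRestrictTowerInto ℚ (Place.Completion (Sum.inr v)) F U hU (g * h)) = _
  rw [map_mul, φ'.2]
  rfl

/-- `res [η] = [η ∘ φ]` for `ContinuousRep.cohomologyRes` along `φ`. [cite: SerreGaloisCohomology1997, I §2.4 (compatible pairs)] -/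
theorem cohomologyRes_oneCocycleClass {G H V : Type} [Group G] [TopologicalSpace G] [IsTopologicalGroup G]
    [Group H] [TopologicalSpace H] [IsTopologicalGroup H] [AddCommGroup V] [TopologicalSpace V]
    [IsTopologicalAddGroup V] (τ : ContinuousRep G ℤ V) (φ : H →ₜ* G) (η : contOneCocycles τ.toTopRep) :
    ContinuousRep.cohomologyRes τ φ 1 (oneCocycleClass τ.toTopRep η) =
      oneCocycleClass (τ.restrict φ).toTopRep (contOneCocycles.pullback φ (X := τ.toTopRep)
        (Y := (τ.restrict φ).toTopRep) (TopRep.ofHom ⟨ContinuousLinearMap.id ℤ V, fun _ => rfl⟩) η) :=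
  map_oneCocycleClass _ _ _ η

omit [ContinuousSMul ℤ_[p] (W.tateModule p)] in
/-- `π_{j+1}` is equivariant for `Γ_F` acting through the tower `Γ_F → Γ_{ℚ_v} → Γ_ℚ` (on the objects
`(tateLocalRep W p v).restrict res_{F/ℚ_v}`, `(E[p^j·p]|_{ℚ_v}).restrict res_{F/ℚ_v}`). [folklore] -/
theorem tateToTorsion_tower_apply (F : Type) [Field F] [Algebra (Place.Completion (Sum.inr v)) F]
    (g : absoluteGaloisGroup F) (a : W.tateModule p) :
    tateToTorsion W p j (((tateLocalRep W p (Sum.inr v)).restrict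
        (absGaloisRestrict (Place.Completion (Sum.inr v)) F)) g a) =
      (((W.torsionGaloisModule ((p : ℤ) ^ j * (p : ℤ))).toLocal (Sum.inr v)).restrict
        (absGaloisRestrict (Place.Completion (Sum.inr v)) F)) g (tateToTorsion W p j a) :=
  Subtype.ext rfl

omit [ContinuousSMul ℤ_[p] (W.tateModule p)] in
/-- `π_{j+1,*} [η] = [π_{j+1} ∘ η]` over `Γ_F` acting through the tower `Γ_F → Γ_{ℚ_v} → Γ_ℚ`.
[cite: SerreGaloisCohomology1997, I §2.4 (compatible pairs)] -/
theorem cohomologyMap_tower_oneCocycleClass (F : Type) [Field F] [Algebra (Place.Completion (Sum.inr v)) F]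
    (η : contOneCocycles ((tateLocalRep W p (Sum.inr v)).restrict
      (absGaloisRestrict (Place.Completion (Sum.inr v)) F)).toTopRep) :
    ContinuousRep.cohomologyMap
        ((tateLocalRep W p (Sum.inr v)).restrict (absGaloisRestrict (Place.Completion (Sum.inr v)) F))
        (((W.torsionGaloisModule ((p : ℤ) ^ j * (p : ℤ))).toLocal (Sum.inr v)).restrict
          (absGaloisRestrict (Place.Completion (Sum.inr v)) F))
        (tateToTorsion W p j) (continuous_tateToTorsion W p j) (tateToTorsion_tower_apply W p j v F) 1
        (oneCocycleClass _ η) =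
      oneCocycleClass _ (contOneCocycles.pullback (ContinuousMonoidHom.id _)
        (X := ((tateLocalRep W p (Sum.inr v)).restrict
          (absGaloisRestrict (Place.Completion (Sum.inr v)) F)).toTopRep)
        (Y := (((W.torsionGaloisModule ((p : ℤ) ^ j * (p : ℤ))).toLocal (Sum.inr v)).restrict
          (absGaloisRestrict (Place.Completion (Sum.inr v)) F)).toTopRep)
        (TopRep.ofHom ⟨⟨(tateToTorsion W p j).toIntLinearMap, continuous_tateToTorsion W p j⟩,
          fun g => ContinuousLinearMap.ext fun a => tateToTorsion_tower_apply W p j v F g a⟩) η) :=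
  map_oneCocycleClass _ _ _ η

omit [ContinuousSMul ℤ_[p] (W.tateModule p)] in
/-- **Naturality: `π_{j+1,*}(res_{F/ℚ_v} h) = res_{F/ℚ_v}(π_{j+1,*} h)`** for `h ∈ H¹(ℚ_v, T_pE)`, both in
`H¹(Γ_F, E[p^j·p])` with the tower action (both are the class of `σ ↦ π_{j+1}(η(res σ))`).
[cite: SerreGaloisCohomology1997, I §2.4 (compatible pairs)] -/
theorem cohomologyMap_cohomologyRes_eq_resTower_tateLocalMap (F : Type) [Field F]
    [Algebra (Place.Completion (Sum.inr v)) F] (h : (tateLocalRep W p (Sum.inr v)).cohomology 1) :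
    ContinuousRep.cohomologyMap
        ((tateLocalRep W p (Sum.inr v)).restrict (absGaloisRestrict (Place.Completion (Sum.inr v)) F))
        (((W.torsionGaloisModule ((p : ℤ) ^ j * (p : ℤ))).toLocal (Sum.inr v)).restrict
          (absGaloisRestrict (Place.Completion (Sum.inr v)) F))
        (tateToTorsion W p j) (continuous_tateToTorsion W p j) (tateToTorsion_tower_apply W p j v F) 1
        (ContinuousRep.cohomologyRes (tateLocalRep W p (Sum.inr v))
          (absGaloisRestrict (Place.Completion (Sum.inr v)) F) 1 h) =
      resTower ℚ (Place.Completion (Sum.inr v)) F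
        (W.torsionGaloisModule ((p : ℤ) ^ j * (p : ℤ))).toTopRep 1 (tateLocalMap W p j (Sum.inr v) h) := by
  obtain ⟨η, rfl⟩ := oneCocycleClass_surjective (tateLocalRep W p (Sum.inr v)).toTopRep h
  refine (congrArg _ (cohomologyRes_oneCocycleClass (tateLocalRep W p (Sum.inr v))
    (absGaloisRestrict (Place.Completion (Sum.inr v)) F) η)).trans ?_
  refine (cohomologyMap_tower_oneCocycleClass W p j v F _).trans ?_
  refine Eq.trans ?_ (congrArg _ (tateLocalMap_oneCocycleClass W p j (Sum.inr v) η)).symm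
  refine Eq.trans ?_ (resTower_oneCocycleClass ℚ (Place.Completion (Sum.inr v)) F
    (W.torsionGaloisModule ((p : ℤ) ^ j * (p : ℤ))).toTopRep (pushCocycle W p j (Sum.inr v) η)).symm
  exact congrArg _ (Subtype.ext (ContinuousMap.ext fun _ => rfl))

omit [ContinuousSMul ℤ_[p] (W.tateModule p)] in
/-- **Exactness over `Γ_F` in the tower**: two classes of `H¹(Γ_F, T_pE)` (tower action) with the same
image in `H¹(Γ_F, E[p^j·p])` differ by `p^{j+1} · H¹(Γ_F, T_pE)` (`KimAtThreeFineKatoLevelExactness` at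
`φ = absGaloisRestrictTower`, read on the definitionally equal objects `(tateLocalRep W p v).restrict res`).
[cite: Kim2022StructureSelmer, §3.3 Lemma 3.11] -/
theorem exists_sub_eq_zsmul_tower (F : Type) [Field F] [Algebra (Place.Completion (Sum.inr v)) F]
    (y₁ y₂ : ((tateLocalRep W p (Sum.inr v)).restrict
      (absGaloisRestrict (Place.Completion (Sum.inr v)) F)).cohomology 1)
    (hy : ContinuousRep.cohomologyMap
        ((tateLocalRep W p (Sum.inr v)).restrict (absGaloisRestrict (Place.Completion (Sum.inr v)) F))
        (((W.torsionGaloisModule ((p : ℤ) ^ j * (p : ℤ))).toLocal (Sum.inr v)).restrict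
          (absGaloisRestrict (Place.Completion (Sum.inr v)) F))
        (tateToTorsion W p j) (continuous_tateToTorsion W p j) (tateToTorsion_tower_apply W p j v F) 1 y₁ =
      ContinuousRep.cohomologyMap
        ((tateLocalRep W p (Sum.inr v)).restrict (absGaloisRestrict (Place.Completion (Sum.inr v)) F))
        (((W.torsionGaloisModule ((p : ℤ) ^ j * (p : ℤ))).toLocal (Sum.inr v)).restrict
          (absGaloisRestrict (Place.Completion (Sum.inr v)) F))
        (tateToTorsion W p j) (continuous_tateToTorsion W p j) (tateToTorsion_tower_apply W p j v F) 1 y₂) :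
    ∃ y', y₁ - y₂ = ((p : ℤ) ^ (j + 1)) • y' :=
  exists_sub_eq_zsmul_of_cohomologyMap_eq W p j
    (absGaloisRestrictTower ℚ (Place.Completion (Sum.inr v)) F) y₁ y₂ hy

/-- **COMPAT from a semi-locally DEFINED value datum**: with `U = cycSubgroup p k r`, `A = ℚ_p ⊗_ℚ ℚ(ζ_m)`,
`φ : H¹(ℚ_v, T_pE) → ℚ_p` (intended `exp*_ω`), `Λ`, `M ≤ A`, a finite family of fields `F_w ⊇ ℚ_v` whose
tower restrictions land in `U`, additive `φ_w : H¹(Γ_{F_w}, T_pE) → V_w` on the tower-restricted Tate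
module and `ι_w : V_w → A`: IF (DEF) `Λ_{k,r}(y) = Σ_w ι_w(φ_w(loc_w^{tower} y))` on cocycles, (RES)
`Σ_w ι_w(φ_w(res_{F_w/ℚ_v} h)) = φ h ⊗ 1`, (LAT) `Σ_w ι_w(φ_w(z_w)) ∈ M`, THEN for every additive `Ψ`
computed on cocycles by `π_{j+1}` and every `y`, `κ₀`, `h` with `res_U κ₀ = Ψ y`, `loc_v κ₀ = π_{j+1,*} h`
there is `μ ∈ M` with `φ h ⊗ 1 − Λ_{k,r}(y) = p^{j+1} · μ` (see the module docstring for the proof).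
[cite: Kim2022StructureSelmer, §3.4.1 and the proof of Thm. 3.13 (arXiv v3 pp. 26–27)] -/
theorem compat_of_semiLocalDef
    (φ : (tateLocalRep W p (Sum.inr v)).cohomology 1 →+ ℚ_[p])
    (Λ : ∀ (k' : ℕ) (r' : Finset (HeightOneSpectrum (𝓞 ℚ))),
      H1 (tateRep W p) (cycSubgroup p k' r') →ₗ[ℤ_[p]] ℚ_[p] ⊗[ℚ] CyclotomicField (cycLevel p k' r') ℚ)
    (M : Submodule ℤ_[p] (ℚ_[p] ⊗[ℚ] CyclotomicField (cycLevel p k r) ℚ))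
    {ι : Type} [Fintype ι] (F : ι → Type) [∀ w, Field (F w)]
    [∀ w, Algebra (Place.Completion (Sum.inr v)) (F w)]
    (hU : ∀ w σ, absGaloisRestrictTower ℚ (Place.Completion (Sum.inr v)) (F w) σ ∈ cycSubgroup p k r)
    {V : ι → Type} [∀ w, AddCommGroup (V w)]
    (φw : ∀ w, ((tateLocalRep W p (Sum.inr v)).restrict
      (absGaloisRestrict (Place.Completion (Sum.inr v)) (F w))).cohomology 1 →+ V w)
    (ιw : ∀ w, V w →+ ℚ_[p] ⊗[ℚ] CyclotomicField (cycLevel p k r) ℚ)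
    (hdef : ∀ (y : H1 (tateRep W p) (cycSubgroup p k r))
        (φ' : contOneCocycles (subgroupRep (tateRep W p).toTopRep (cycSubgroup p k r))),
        oneCocycleClass _ φ' = y →
        ∀ ψT : ∀ w, contOneCocycles ((tateLocalRep W p (Sum.inr v)).restrict
            (absGaloisRestrict (Place.Completion (Sum.inr v)) (F w))).toTopRep,
          (∀ w σ, (ψT w).1 σ =
            φ'.1 ⟨absGaloisRestrictTower ℚ (Place.Completion (Sum.inr v)) (F w) σ, hU w σ⟩) →
          Λ k r y = ∑ w, ιw w (φw w (oneCocycleClass _ (ψT w))))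
    (hres : ∀ h : (tateLocalRep W p (Sum.inr v)).cohomology 1,
      ∑ w, ιw w (φw w (ContinuousRep.cohomologyRes (tateLocalRep W p (Sum.inr v))
        (absGaloisRestrict (Place.Completion (Sum.inr v)) (F w)) 1 h)) =
        (φ h) ⊗ₜ[ℚ] (1 : CyclotomicField (cycLevel p k r) ℚ))
    (hlat : ∀ z : ∀ w, ((tateLocalRep W p (Sum.inr v)).restrict
        (absGaloisRestrict (Place.Completion (Sum.inr v)) (F w))).cohomology 1,
      ∑ w, ιw w (φw w (z w)) ∈ M) :
    ∀ (Ψ : H1 (tateRep W p) (cycSubgroup p k r) →+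
        continuousCohomology 1 (subgroupRep
          (W.torsionGaloisModule ((p : ℤ) ^ j * (p : ℤ))).toTopRep (cycSubgroup p k r))),
      (∀ (φ' : contOneCocycles (subgroupRep (tateRep W p).toTopRep (cycSubgroup p k r)))
          (ψ : contOneCocycles (subgroupRep
            (W.torsionGaloisModule ((p : ℤ) ^ j * (p : ℤ))).toTopRep (cycSubgroup p k r))),
          (∀ g, ((ψ.1 g : geomTorsion W ((p : ℤ) ^ j * (p : ℤ))) : geomPoints W) =
            TateModule.proj p (j + 1) (φ'.1 g)) →
          Ψ (oneCocycleClass _ φ') = oneCocycleClass _ ψ) →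
      ∀ (y : H1 (tateRep W p) (cycSubgroup p k r))
        (κ₀ : galoisCohomology (W.torsionGaloisModule ((p : ℤ) ^ j * (p : ℤ))) 1)
        (h : (tateLocalRep W p (Sum.inr v)).cohomology 1),
        resSubgroup (W.torsionGaloisModule ((p : ℤ) ^ j * (p : ℤ))).toTopRep (cycSubgroup p k r) 1 κ₀ =
            Ψ y →
        galoisCohomology.localization (W.torsionGaloisModule ((p : ℤ) ^ j * (p : ℤ))) (Sum.inr v) 1 κ₀ =
            tateLocalMap W p j (Sum.inr v) h →
        ∃ μ ∈ M, (φ h ⊗ₜ[ℚ] (1 : CyclotomicField (cycLevel p k r) ℚ)) - Λ k r y =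
          ((p : ℤ_[p]) ^ (j + 1)) • (μ : ℚ_[p] ⊗[ℚ] CyclotomicField (cycLevel p k r) ℚ) := by
  intro Ψ hΨ y κ₀ h hresκ hloc
  classical
  obtain ⟨φ', rfl⟩ :=
    oneCocycleClass_surjective (subgroupRep (tateRep W p).toTopRep (cycSubgroup p k r)) y
  obtain ⟨ψ, hψ⟩ := exists_level_pushCocycle W p j (cycSubgroup p k r) φ'
  have hΨy : Ψ (oneCocycleClass _ φ') = oneCocycleClass _ ψ :=
    hΨ φ' ψ fun g => by rw [hψ g, coe_tateToTorsion_apply]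
  have hT : ∀ w, ∃ ψT : contOneCocycles ((tateLocalRep W p (Sum.inr v)).restrict
      (absGaloisRestrict (Place.Completion (Sum.inr v)) (F w))).toTopRep,
      ∀ σ, ψT.1 σ = φ'.1 ⟨absGaloisRestrictTower ℚ (Place.Completion (Sum.inr v)) (F w) σ, hU w σ⟩ :=
    fun w => exists_level_towerCocycle W p v (F w) (cycSubgroup p k r) (hU w) φ'
  choose ψT hψT using hT
  -- for every `w`: `π_{j+1,*}(res_w h) = π_{j+1,*}[ψT w]` in `H¹(Γ_{F_w}, E[p^j·p])`
  have hkey : ∀ w, ContinuousRep.cohomologyMap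
      ((tateLocalRep W p (Sum.inr v)).restrict (absGaloisRestrict (Place.Completion (Sum.inr v)) (F w)))
      (((W.torsionGaloisModule ((p : ℤ) ^ j * (p : ℤ))).toLocal (Sum.inr v)).restrict
        (absGaloisRestrict (Place.Completion (Sum.inr v)) (F w)))
      (tateToTorsion W p j) (continuous_tateToTorsion W p j) (tateToTorsion_tower_apply W p j v (F w)) 1
      (ContinuousRep.cohomologyRes (tateLocalRep W p (Sum.inr v))
        (absGaloisRestrict (Place.Completion (Sum.inr v)) (F w)) 1 h) =
    ContinuousRep.cohomologyMap
      ((tateLocalRep W p (Sum.inr v)).restrict (absGaloisRestrict (Place.Completion (Sum.inr v)) (F w)))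
      (((W.torsionGaloisModule ((p : ℤ) ^ j * (p : ℤ))).toLocal (Sum.inr v)).restrict
        (absGaloisRestrict (Place.Completion (Sum.inr v)) (F w)))
      (tateToTorsion W p j) (continuous_tateToTorsion W p j) (tateToTorsion_tower_apply W p j v (F w)) 1
      (oneCocycleClass _ (ψT w)) := by
    intro w
    refine (cohomologyMap_cohomologyRes_eq_resTower_tateLocalMap W p j v (F w) h).trans ?_
    refine (congrArg (resTower ℚ (Place.Completion (Sum.inr v)) (F w)
      (W.torsionGaloisModule ((p : ℤ) ^ j * (p : ℤ))).toTopRep 1) hloc.symm).trans ?_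
    refine (locTower_resSubgroup ℚ (Place.Completion (Sum.inr v)) (F w)
      (W.torsionGaloisModule ((p : ℤ) ^ j * (p : ℤ))).toTopRep (cycSubgroup p k r) (hU w) 1 κ₀).symm.trans ?_
    refine (congrArg (locTower ℚ (Place.Completion (Sum.inr v)) (F w)
      (W.torsionGaloisModule ((p : ℤ) ^ j * (p : ℤ))).toTopRep (cycSubgroup p k r) (hU w) 1)
      (hresκ.trans hΨy)).trans ?_
    refine (locTower_oneCocycleClass ℚ (Place.Completion (Sum.inr v)) (F w)
      (W.torsionGaloisModule ((p : ℤ) ^ j * (p : ℤ))).toTopRep (cycSubgroup p k r) (hU w) ψ).trans ?_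
    refine Eq.trans ?_ (cohomologyMap_tower_oneCocycleClass W p j v (F w) (ψT w)).symm
    refine congrArg _ (Subtype.ext (ContinuousMap.ext fun σ => ?_))
    change ψ.1 (absGaloisRestrictTowerInto ℚ (Place.Completion (Sum.inr v)) (F w) _ (hU w) σ) =
      tateToTorsion W p j ((ψT w).1 σ)
    rw [hψ, hψT]
    rfl
  have hex : ∀ w, ∃ y', ContinuousRep.cohomologyRes (tateLocalRep W p (Sum.inr v))
      (absGaloisRestrict (Place.Completion (Sum.inr v)) (F w)) 1 h -
      (show ((tateLocalRep W p (Sum.inr v)).restrict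
        (absGaloisRestrict (Place.Completion (Sum.inr v)) (F w))).cohomology 1 from
          oneCocycleClass _ (ψT w)) =
      ((p : ℤ) ^ (j + 1)) • y' :=
    fun w => exists_sub_eq_zsmul_tower W p j v (F w) _ _ (hkey w)
  choose y' hy' using hex
  refine ⟨∑ w, ιw w (φw w (y' w)), hlat y', ?_⟩
  rw [← hres h, hdef _ φ' rfl ψT hψT, ← Finset.sum_sub_distrib, Finset.smul_sum]
  refine Finset.sum_congr rfl fun w _ => ?_
  rw [← map_sub, ← map_sub, hy' w, map_zsmul, map_zsmul, ← Int.cast_smul_eq_zsmul ℤ_[p]]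
  push_cast
  rfl

/-- **COMPAT in the verbatim shape of `hK`** (`stub_definedKatoPackage`, kim3 p490927: tame level `k = 0`,
torsion exponent `t = 0`, i.e. the factor `p⁰ •`): a restatement of `compat_of_semiLocalDef`.
[cite: Kim2022StructureSelmer, §3.4.1 and the proof of Thm. 3.13 (arXiv v3 pp. 26–27)] -/
theorem compat_of_semiLocalDef_pow_zero
    (φ : (tateLocalRep W p (Sum.inr v)).cohomology 1 →+ ℚ_[p])
    (Λ : ∀ (k' : ℕ) (r' : Finset (HeightOneSpectrum (𝓞 ℚ))),
      H1 (tateRep W p) (cycSubgroup p k' r') →ₗ[ℤ_[p]] ℚ_[p] ⊗[ℚ] CyclotomicField (cycLevel p k' r') ℚ)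
    (M : Submodule ℤ_[p] (ℚ_[p] ⊗[ℚ] CyclotomicField (cycLevel p 0 r) ℚ))
    {ι : Type} [Fintype ι] (F : ι → Type) [∀ w, Field (F w)]
    [∀ w, Algebra (Place.Completion (Sum.inr v)) (F w)]
    (hU : ∀ w σ, absGaloisRestrictTower ℚ (Place.Completion (Sum.inr v)) (F w) σ ∈ cycSubgroup p 0 r)
    {V : ι → Type} [∀ w, AddCommGroup (V w)]
    (φw : ∀ w, ((tateLocalRep W p (Sum.inr v)).restrict
      (absGaloisRestrict (Place.Completion (Sum.inr v)) (F w))).cohomology 1 →+ V w)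
    (ιw : ∀ w, V w →+ ℚ_[p] ⊗[ℚ] CyclotomicField (cycLevel p 0 r) ℚ)
    (hdef : ∀ (y : H1 (tateRep W p) (cycSubgroup p 0 r))
        (φ' : contOneCocycles (subgroupRep (tateRep W p).toTopRep (cycSubgroup p 0 r))),
        oneCocycleClass _ φ' = y →
        ∀ ψT : ∀ w, contOneCocycles ((tateLocalRep W p (Sum.inr v)).restrict
            (absGaloisRestrict (Place.Completion (Sum.inr v)) (F w))).toTopRep,
          (∀ w σ, (ψT w).1 σ =
            φ'.1 ⟨absGaloisRestrictTower ℚ (Place.Completion (Sum.inr v)) (F w) σ, hU w σ⟩) →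
          Λ 0 r y = ∑ w, ιw w (φw w (oneCocycleClass _ (ψT w))))
    (hres : ∀ h : (tateLocalRep W p (Sum.inr v)).cohomology 1,
      ∑ w, ιw w (φw w (ContinuousRep.cohomologyRes (tateLocalRep W p (Sum.inr v))
        (absGaloisRestrict (Place.Completion (Sum.inr v)) (F w)) 1 h)) =
        (φ h) ⊗ₜ[ℚ] (1 : CyclotomicField (cycLevel p 0 r) ℚ))
    (hlat : ∀ z : ∀ w, ((tateLocalRep W p (Sum.inr v)).restrict
        (absGaloisRestrict (Place.Completion (Sum.inr v)) (F w))).cohomology 1,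
      ∑ w, ιw w (φw w (z w)) ∈ M)
    (Ψ : H1 (tateRep W p) (cycSubgroup p 0 r) →+
        continuousCohomology 1 (subgroupRep
          (W.torsionGaloisModule ((p : ℤ) ^ j * (p : ℤ))).toTopRep (cycSubgroup p 0 r)))
    (hΨ : ∀ (φ' : contOneCocycles (subgroupRep (tateRep W p).toTopRep (cycSubgroup p 0 r)))
        (ψ : contOneCocycles (subgroupRep
          (W.torsionGaloisModule ((p : ℤ) ^ j * (p : ℤ))).toTopRep (cycSubgroup p 0 r))),
        (∀ g, ((ψ.1 g : geomTorsion W ((p : ℤ) ^ j * (p : ℤ))) : geomPoints W) =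
          TateModule.proj p (j + 1) (φ'.1 g)) →
        Ψ (oneCocycleClass _ φ') = oneCocycleClass _ ψ)
    (y : H1 (tateRep W p) (cycSubgroup p 0 r))
    (κ₀ : galoisCohomology (W.torsionGaloisModule ((p : ℤ) ^ j * (p : ℤ))) 1)
    (h : (tateLocalRep W p (Sum.inr v)).cohomology 1)
    (hresκ : resSubgroup (W.torsionGaloisModule ((p : ℤ) ^ j * (p : ℤ))).toTopRep (cycSubgroup p 0 r) 1 κ₀ =
      Ψ y)
    (hloc : galoisCohomology.localization (W.torsionGaloisModule ((p : ℤ) ^ j * (p : ℤ))) (Sum.inr v) 1 κ₀ =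
      tateLocalMap W p j (Sum.inr v) h) :
    ∃ μ ∈ M, (φ h ⊗ₜ[ℚ] (1 : CyclotomicField (cycLevel p 0 r) ℚ)) -
        (((p : ℕ) : ℤ_[p]) ^ (0 : ℕ)) • Λ 0 r y =
      (((p : ℕ) : ℤ_[p]) ^ (j + 1)) • (μ : ℚ_[p] ⊗[ℚ] CyclotomicField (cycLevel p 0 r) ℚ) := by
  rw [pow_zero, one_smul]
  exact compat_of_semiLocalDef W p j 0 r v φ Λ M F hU φw ιw hdef hres hlat Ψ hΨ y κ₀ h hresκ hloc

end Compat

end Summit.BirchSwinnertonDyer.BirchSwinnertonDyer.Theorems.KimAtThreeFineKatoLevelCompat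

end
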